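import Summits.MatrixMultiplication.OmegaCensus.STPPVosperSlackOnePairing
import Summits.MatrixMultiplication.OmegaCensus.STPPVosperSlackOneCoverStepsWd

/-!
# ω-census (abelian STPP census): steps for the slack-1 laws WITH THE A-PAIRING premise — table wrappers (γ, β) and the α₂ admissible-offset checker (kernel)

HONEST FRAMING (pub-omega census; verbatim): lottery ticket; floor = certified bounds/negative ranges.
Census STRUCTURE (seat pub-omega-stpp-2 gen 26, 2026-08-28), family (b2).  Companions of `STPPVosperSlackOnePairing.lean` for the law
`no_isSTPP_of_slack_one_coverP_prime_a2` (`STPPVosperSlackOneCoverLawA2P.lean`):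
* `val_mem_of_nat_tableX_prime` — the prime-order table wrapper `val_mem_of_nat_table_prime` with an ARBITRARY extra premise `P j t` on the table
  (used with `P` = the `coverByF` pairing test of case γ);
* `tableBetaP` / `tableBetaP_spec` — the case-β table with the pairing conjunct, and `holed_ratio_val_memP` — `holed_ratio_val_mem` feeding it
  (the pairing fact comes from `coverByF_blockSum`, UNCONDITIONAL);
* `alpha2AdmOKp` / `alpha2AdmOKp_spec` — the admissible-offset checker of case α₂ (`alpha2AdmOKd`) with the pairing conjunct, for kill files.
Nothing here is progress on `ω`.

References: H. Cohn, R. Kleinberg, B. Szegedy, C. Umans, FOCS 2005 (arXiv:math/0511460), Def. 5.1; A. G. Vosper, J. London Math. Soc. 31 (1956);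
Y. O. Hamidoune, Ø. J. Rødseth, Acta Arith. 92 (2000) 251–262.
-/

open Finset
open scoped Pointwise

namespace Summit.MatrixMultiplication.OmegaCensus.CubeNB

open Literature.Computability.AlgebraicComplexity
open Literature.Combinatorics.Additive
open Summit.MatrixMultiplication.OmegaCensus.STPPKneser

/-! ## §1 The γ table wrapper with an extra premise -/

section Gamma

variable {p : ℕ} [hp : Fact p.Prime]

/-- **Table wrapper at prime order with an extra premise.**  As `val_mem_of_nat_table_prime`, the `ℕ`-table being allowed one more hypothesis
`P j t` about the ratio and the start of the progression; the caller supplies `P j.val t.val`. [folklore] -/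
theorem val_mem_of_nat_tableX_prime {n m r : ℕ} {J : Finset ℕ} (hn : n ≤ p) (hm : m ≤ p) (P : ℕ → ℕ → Prop)
    (htable : ∀ j < p, ∀ t < p, (∀ i < m, (t + j * i) % p < n) →
      (∀ k < m, r ∣ (t + j * k) % p - #((range m).filter fun i => (t + j * i) % p < (t + j * k) % p)) → P j t → j ∈ J)
    {t j : ZMod p} (hj : j ≠ 0) (hSV : apFinset t j m ⊆ apFinset 0 1 n)
    (hgap : ∀ x ∈ apFinset t j m, r ∣ x.val - #((apFinset t j m).filter fun y => y.val < x.val)) (hP : P j.val t.val) : j.val ∈ J := by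
  have hpos : ∀ i, i < m → (t.val + j.val * i) % p < n := by
    intro i hi
    rw [← val_add_nsmul_zmod]
    exact (mem_apFinset_zero_one_iff hn).1 (hSV (mem_apFinset.2 ⟨i, hi, rfl⟩))
  have hcount : ∀ c : ℕ, #((apFinset t j m).filter fun y => y.val < c) =
      #((range m).filter fun i => (t.val + j.val * i) % p < c) := by
    intro c
    have himg : apFinset t j m = (range m).image fun i : ℕ => t + i • j := rfl
    rw [himg, Finset.filter_image, Finset.card_image_of_injOn]
    · apply congrArg Finset.card
      apply Finset.filter_congr
      intro i _
      rw [val_add_nsmul_zmod]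
    · intro i hi i' hi' h
      have him := Finset.mem_range.1 (Finset.mem_filter.1 (Finset.mem_coe.1 hi)).1
      have him' := Finset.mem_range.1 (Finset.mem_filter.1 (Finset.mem_coe.1 hi')).1
      exact zmod_natMul_injOn hj (by omega) (by omega) h
  have hgap' : ∀ k, k < m → r ∣ (t.val + j.val * k) % p -
      #((range m).filter fun i => (t.val + j.val * i) % p < (t.val + j.val * k) % p) := by
    intro k hk
    have h := hgap (t + k • j) (mem_apFinset.2 ⟨k, hk, rfl⟩)
    rwa [hcount, val_add_nsmul_zmod] at h
  exact htable j.val (ZMod.val_lt j) t.val (ZMod.val_lt t) hpos hgap' hP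

end Gamma

/-! ## §2 Case β with the pairing conjunct -/

section Beta

/-- **Case-β table checker with the A-pairing** (`Bool`).  As `tableBeta`, a row `(j, t, h, g₀)` counting only when, besides the greedy `B`-tiling of the
holed window minus the positions, the exact cover by the combined pattern `patN p j a ([0,b] ∖ {b − g₀ − 1})` succeeds (`coverByF`). [folklore] -/
def tableBetaP (p n₁ m b a fuel : ℕ) (J : Finset ℕ) : Bool :=
  (List.range p).all fun j => (List.range p).all fun t =>
    decide (j ∈ J) ||
    !((List.range m).all fun i => decide ((t + j * i) % p < n₁)) ||
    (List.range n₁).all fun h =>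
      decide (h ∈ (range m).image fun i => (t + j * i) % p) ||
      (List.range b).all fun g₀ =>
        !(greedyTiles ((range (b + 1)).erase (g₀ + 1)) n₁
            (((range n₁).erase h).filter fun x => x ∉ (range m).image fun i => (t + j * i) % p)) ||
        !(coverByF p (patN p j a ((range (b + 1)).erase (b - (g₀ + 1)))) fuel
            (((range n₁).erase h).filter fun x => x ∉ (range m).image fun i => (t + j * i) % p))

/-- **Meaning of the case-β checker with the pairing.** [folklore] -/
theorem tableBetaP_spec {p n₁ m b a fuel : ℕ} {J : Finset ℕ} (h : tableBetaP p n₁ m b a fuel J = true) :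
    ∀ j < p, ∀ t < p, (∀ i < m, (t + j * i) % p < n₁) → ∀ hh < n₁, hh ∉ (range m).image (fun i => (t + j * i) % p) →
      ∀ g₀ < b, greedyTiles ((range (b + 1)).erase (g₀ + 1)) n₁
          (((range n₁).erase hh).filter fun x => x ∉ (range m).image fun i => (t + j * i) % p) = true →
        coverByF p (patN p j a ((range (b + 1)).erase (b - (g₀ + 1)))) fuel
          (((range n₁).erase hh).filter fun x => x ∉ (range m).image fun i => (t + j * i) % p) = true → j ∈ J := by
  intro j hj t ht hwin hh hhh hhole g₀ hg₀ hgreedy hcover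
  rw [tableBetaP, List.all_eq_true] at h
  have h1 := h j (List.mem_range.2 hj)
  rw [List.all_eq_true] at h1
  have h2 := h1 t (List.mem_range.2 ht)
  rw [Bool.or_eq_true, Bool.or_eq_true, decide_eq_true_eq, Bool.not_eq_true', List.all_eq_true] at h2
  rcases h2 with (hJ | h3) | h3
  · exact hJ
  · exfalso
    rw [Bool.eq_false_iff] at h3
    apply h3
    rw [List.all_eq_true]
    intro i hi
    rw [decide_eq_true_eq]
    exact hwin i (List.mem_range.1 hi)
  · exfalso
    have h4 := h3 hh (List.mem_range.2 hhh)
    rw [Bool.or_eq_true, decide_eq_true_eq, List.all_eq_true] at h4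
    rcases h4 with h5 | h5
    · exact hhole h5
    · have h6 := h5 g₀ (List.mem_range.2 hg₀)
      rw [Bool.or_eq_true, Bool.not_eq_true', Bool.not_eq_true', hgreedy, hcover] at h6
      rcases h6 with h6 | h6 <;> exact Bool.noConfusion h6

variable {p : ℕ} [hp : Fact p.Prime] {N : ℕ} {A B C : Fin N → Finset (ZMod p)}

/-- **The holed ratio lemma (case β) with the pairing**: as `holed_ratio_val_mem`, against the table `tableBetaP`; the extra inputs are the shape of
`−Aᵢ` (an `a`-progression of step `d`) and a bound `fuel ≥ |Cᵢ|`; the pairing premise of the table is discharged by `coverByF_blockSum`.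
[cite: CohnKleinbergSzegedyUmans2005, Def. 5.1] -/
theorem holed_ratio_val_memP (hS : IsSTPP A B C) (i : Fin N) {e' β v d c₀ s₀ : ZMod p} {b g₁ n m a fuel : ℕ} (he' : e' ≠ 0) (hd : d ≠ 0)
    (hg₁ : g₁ < b) (hB : B i = apErase β e' (b + 1) g₁) (ha : a ≤ p) (hSn : (A i).image (fun x => (0 : ZMod p) - x) = apFinset s₀ d a)
    (hfuel : #(C i) ≤ fuel) {SY : Finset (ZMod p)} (hSY : SY = apFinset c₀ d m)
    (hWV : Disjoint ((((A i) ×ˢ ((B i) ×ˢ (C i))).image fun q : ZMod p × ZMod p × ZMod p => (0 : ZMod p) + q.2.2 - q.1 - q.2.1)) SY)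
    (hVsub : (((A i) ×ˢ ((B i) ×ˢ (C i))).image fun q : ZMod p × ZMod p × ZMod p => (0 : ZMod p) + q.2.2 - q.1 - q.2.1) ∪ SY ⊆
      apFinset v e' (n + 1))
    (hVcard : #((((A i) ×ˢ ((B i) ×ˢ (C i))).image fun q : ZMod p × ZMod p × ZMod p => (0 : ZMod p) + q.2.2 - q.1 - q.2.1) ∪ SY) = n)
    (hnb : n + 1 + b ≤ p) (hPcard : #((A i) ×ˢ (C i)) ≤ n + 1) {J : Finset ℕ}
    (htable : ∀ j < p, ∀ t < p, (∀ i < m, (t + j * i) % p < n + 1) → ∀ hh < n + 1, hh ∉ (range m).image (fun i => (t + j * i) % p) →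
      ∀ g₀ < b, greedyTiles ((range (b + 1)).erase (g₀ + 1)) (n + 1)
        (((range (n + 1)).erase hh).filter fun x => x ∉ (range m).image fun i => (t + j * i) % p) = true →
        coverByF p (patN p j a ((range (b + 1)).erase (b - (g₀ + 1)))) fuel
          (((range (n + 1)).erase hh).filter fun x => x ∉ (range m).image fun i => (t + j * i) % p) = true → j ∈ J) :
    (e'⁻¹ * d).val ∈ J := by
  set W := ((A i) ×ˢ ((B i) ×ˢ (C i))).image fun q : ZMod p × ZMod p × ZMod p => (0 : ZMod p) + q.2.2 - q.1 - q.2.1 with hW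
  obtain ⟨hWeq0, hPdisj0⟩ := W_eq_biUnion_blocks hS i
  rw [← hW] at hWeq0
  set P := (A i) ×ˢ (C i) with hP
  -- transport
  set u : ZMod p := e'⁻¹ with hu
  set w : ZMod p := -(u * v) with hw
  have hu0 : u ≠ 0 := inv_ne_zero he'
  have hue : u * e' = 1 := inv_mul_cancel₀ he'
  have hφinj : Function.Injective (fun x : ZMod p => u * x + w) := affine_injective hu0 w
  have hφVsup : (apFinset v e' (n + 1)).image (fun x => u * x + w) = apFinset 0 1 (n + 1) := by
    rw [image_affine_apFinset, hue, hw, add_neg_cancel]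
  set G : Finset ℕ := (range (b + 1)).erase (b - g₁) with hG
  have hG0 : 0 ∈ G := Finset.mem_erase.2 ⟨by omega, Finset.mem_range.2 (by omega)⟩
  have hGsub : G ⊆ range (b + 1) := Finset.erase_subset _ _
  set gz : ZMod p × ZMod p → ZMod p := fun xc => u * ((xc.2 - xc.1) - β - b • e') + w with hgz
  have hφblk : ∀ xc : ZMod p × ZMod p,
      ((B i).image fun y => (xc.2 - xc.1) - y).image (fun x => u * x + w) = G.image (fun ii : ℕ => gz xc + (ii : ZMod p)) := by
    intro xc
    rw [hB, Finset.image_image]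
    have h := image_sub_apErase_affine (β := β) (c := xc.2 - xc.1) (w := w) hue (le_of_lt hg₁)
    exact h
  set T := W.image (fun x => u * x + w) with hT
  have hTeq : T = P.biUnion fun xc => G.image (fun ii : ℕ => gz xc + (ii : ZMod p)) := by
    rw [hT, hWeq0, Finset.biUnion_image]
    exact Finset.biUnion_congr rfl fun xc _ => hφblk xc
  have hTdisj : (P : Set (ZMod p × ZMod p)).PairwiseDisjoint fun xc => G.image (fun ii : ℕ => gz xc + (ii : ZMod p)) := by
    intro xc hxc xc' hxc' hne
    rw [Function.onFun, ← hφblk, ← hφblk]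
    exact (Finset.disjoint_image hφinj).2 (hPdisj0 hxc hxc' hne)
  set S := SY.image (fun x => u * x + w) with hSdef
  have hSeq : S = apFinset (u * c₀ + w) (u * d) m := by rw [hSdef, hSY, image_affine_apFinset]
  set I := apFinset (0 : ZMod p) 1 (n + 1) with hI
  set V' := (W ∪ SY).image (fun x => u * x + w) with hV'
  have hV'sub : V' ⊆ I := by
    rw [hV', ← hφVsup]; exact Finset.image_subset_image hVsub
  have hV'card : #V' = n := by rw [hV', Finset.card_image_of_injective _ hφinj, hVcard]
  have hn1 : n + 1 ≤ p := by omega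
  have hIcard : #I = n + 1 := card_apFinset one_ne_zero hn1
  obtain ⟨h₀, hh₀⟩ : ∃ h₀, I \ V' = {h₀} := Finset.card_eq_one.1 (by rw [Finset.card_sdiff_of_subset hV'sub, hIcard, hV'card]; omega)
  have hh₀I : h₀ ∈ I := (Finset.mem_sdiff.1 (by rw [hh₀]; exact Finset.mem_singleton_self _)).1
  have hh₀V : h₀ ∉ V' := (Finset.mem_sdiff.1 (by rw [hh₀]; exact Finset.mem_singleton_self _)).2
  have hV'TS : V' = T ∪ S := by rw [hV', hT, hSdef, Finset.image_union]
  have hTSdisj : Disjoint T S := by rw [hT, hSdef]; exact (Finset.disjoint_image hφinj).2 hWV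
  have hTI : T ⊆ I := fun x hx => hV'sub (by rw [hV'TS]; exact Finset.mem_union_left _ hx)
  have hSI : S ⊆ I := fun x hx => hV'sub (by rw [hV'TS]; exact Finset.mem_union_right _ hx)
  -- the tiles, transported to ℕ
  have hwin : ∀ xc ∈ P, ∀ ii ∈ G, gz xc + (ii : ZMod p) ∈ apFinset (0 : ZMod p) 1 (n + 1) := by
    intro xc hxc ii hii
    apply hTI
    rw [hTeq]
    exact Finset.mem_biUnion.2 ⟨xc, hxc, Finset.mem_image.2 ⟨ii, hii, rfl⟩⟩
  obtain ⟨hTval, hdisjℕ⟩ := val_image_tiles (n := n + 1) (b := b) hnb hGsub hG0 P gz hwin hTdisj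
  have hgreedy0 := greedyTiles_of_tiling G hG0 (fun xc => (gz xc).val) (n + 1) P hPcard hdisjℕ
  rw [← hTval, ← hTeq] at hgreedy0
  -- identify T.image val with the table's set
  set t' : ZMod p := u * c₀ + w with ht'
  set j' : ZMod p := u * d with hj'
  have hj'0 : j' ≠ 0 := mul_ne_zero hu0 hd
  have hposval : ∀ k, (t' + k • j').val = (t'.val + j'.val * k) % p := fun k => val_add_nsmul_zmod t' j' k
  have hSmem : ∀ y, y ∈ S ↔ ∃ k, k < m ∧ t' + k • j' = y := by
    intro y; rw [hSeq, mem_apFinset]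
  have hV'E : T ∪ S = I.erase h₀ := by
    rw [← hV'TS]
    ext x
    rw [Finset.mem_erase]
    constructor
    · intro hx
      exact ⟨fun hxe => hh₀V (hxe ▸ hx), hV'sub hx⟩
    · rintro ⟨hne, hxI⟩
      by_contra hxV'
      have : x ∈ I \ V' := Finset.mem_sdiff.2 ⟨hxI, hxV'⟩
      rw [hh₀, Finset.mem_singleton] at this
      exact hne this
  have hSval : S.image ZMod.val = (range m).image fun k => (t'.val + j'.val * k) % p := by rw [hSeq]; exact image_val_apFinset' t' j' m
  have hXeq : T.image ZMod.val = ((range (n + 1)).erase h₀.val).filter fun x => x ∉ (range m).image fun k => (t'.val + j'.val * k) % p :=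
    image_val_eq_erase_filter hn1 hTSdisj hV'E hSval
  rw [hXeq] at hgreedy0
  -- the pairing premise (UNCONDITIONAL)
  have hBD : ∀ δ ∈ (range (b + 1)).erase g₁, δ < p := fun δ hδ => by
    have := Finset.mem_range.1 (Finset.mem_of_mem_erase hδ); omega
  have hBimg : B i = ((range (b + 1)).erase g₁).image fun δ : ℕ => β + δ • e' := by rw [hB]; rfl
  have hcover0 := coverByF_blockSum hS i (w := w) hue ha hSn hBD hBimg hfuel
  rw [← hW, ← hT, hXeq] at hcover0
  -- table
  have hwinS : ∀ k < m, (t'.val + j'.val * k) % p < n + 1 := by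
    intro k hk
    rw [← hposval]
    exact (mem_apFinset_zero_one_iff hn1).1 (hSI ((hSmem _).2 ⟨k, hk, rfl⟩))
  have hh₀lt : h₀.val < n + 1 := (mem_apFinset_zero_one_iff hn1).1 hh₀I
  have hhole : h₀.val ∉ (range m).image fun k => (t'.val + j'.val * k) % p := by
    intro hmem
    obtain ⟨k, hk, hkx⟩ := Finset.mem_image.1 hmem
    have hmem' : h₀ ∈ S := (hSmem _).2 ⟨k, Finset.mem_range.1 hk, ZMod.val_injective p (by rw [hposval, hkx])⟩
    exact hh₀V (by rw [hV'TS]; exact Finset.mem_union_right _ hmem')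
  obtain ⟨g₀, hg₀⟩ : ∃ g₀, b - g₁ = g₀ + 1 := ⟨b - g₁ - 1, by omega⟩
  have hg₀b : g₀ < b := by omega
  have hg₁e : g₁ = b - (g₀ + 1) := by omega
  rw [hG, hg₀] at hgreedy0
  rw [hg₁e] at hcover0
  have hval := htable j'.val (ZMod.val_lt j') t'.val (ZMod.val_lt t') hwinS h₀.val hh₀lt hhole g₀ hg₀b hgreedy0 hcover0
  rw [hj'] at hval
  exact hval

end Beta

/-! ## §3 The α₂ admissible-offset checker with the pairing conjunct -/

section Alpha

/-- **Admissible offsets of one `(j, ℓ₁)` with the disjointness test AND the A-pairing** (`Bool`): a pair of run starts `(t₁, t₂)` counts as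
admissible only if, besides the window tests, the cardinality test `L + 2`, and the prefix test, the exact cover of the window complement by the
combined pattern `patN p j a [0,b)` succeeds. [folklore] -/
def alpha2AdmOKp (p n₁ L r a fuel : ℕ) (J : Finset ℕ) (j ℓ₁ : ℕ) (D : List ℕ) : Bool :=
  decide (j ∈ J) ||
    ((List.range p).filter fun t₁ => (List.range (ℓ₁ + 1)).all fun i => decide ((t₁ + j * i) % p < n₁)).all fun t₁ =>
      ((List.range p).filter fun t₂ => (List.range (L - ℓ₁ + 1)).all fun i => decide ((t₂ + j * i) % p < n₁)).all fun t₂ =>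
        !(decide (#((range (ℓ₁ + 1)).image (fun i => (t₁ + j * i) % p) ∪ (range (L - ℓ₁ + 1)).image (fun i => (t₂ + j * i) % p)) = L + 2)) ||
        !(prefixOK r ((range (ℓ₁ + 1)).image (fun i => (t₁ + j * i) % p) ∪ (range (L - ℓ₁ + 1)).image (fun i => (t₂ + j * i) % p))) ||
        !(coverByF p (patN p j a (range r)) fuel ((range n₁).filter fun x =>
            x ∉ (range (ℓ₁ + 1)).image (fun i => (t₁ + j * i) % p) ∪ (range (L - ℓ₁ + 1)).image (fun i => (t₂ + j * i) % p))) ||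
          decide ((t₂ + p - t₁) % p ∈ D)

/-- **Meaning of `alpha2AdmOKp`.** [folklore] -/
theorem alpha2AdmOKp_spec {p n₁ L r a fuel : ℕ} {J : Finset ℕ} {j ℓ₁ : ℕ} {D : List ℕ} (h : alpha2AdmOKp p n₁ L r a fuel J j ℓ₁ D = true) :
    ∀ t₁ < p, ∀ t₂ < p, (∀ i < ℓ₁ + 1, (t₁ + j * i) % p < n₁) → (∀ i < L - ℓ₁ + 1, (t₂ + j * i) % p < n₁) →
      #((range (ℓ₁ + 1)).image (fun i => (t₁ + j * i) % p) ∪ (range (L - ℓ₁ + 1)).image (fun i => (t₂ + j * i) % p)) = L + 2 →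
      prefixOK r ((range (ℓ₁ + 1)).image (fun i => (t₁ + j * i) % p) ∪ (range (L - ℓ₁ + 1)).image (fun i => (t₂ + j * i) % p)) = true →
      coverByF p (patN p j a (range r)) fuel ((range n₁).filter fun x =>
          x ∉ (range (ℓ₁ + 1)).image (fun i => (t₁ + j * i) % p) ∪ (range (L - ℓ₁ + 1)).image (fun i => (t₂ + j * i) % p)) = true →
      j ∈ J ∨ (t₂ + p - t₁) % p ∈ D := by
  intro t₁ ht₁ t₂ ht₂ hw1 hw2 hcard hpre hcov
  rw [alpha2AdmOKp, Bool.or_eq_true, decide_eq_true_eq] at h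
  rcases h with hJ | h
  · exact Or.inl hJ
  right
  rw [List.all_eq_true] at h
  have hT₁ : t₁ ∈ (List.range p).filter fun t₁ => (List.range (ℓ₁ + 1)).all fun i => decide ((t₁ + j * i) % p < n₁) := by
    rw [List.mem_filter, List.mem_range, List.all_eq_true]
    exact ⟨ht₁, fun i hi => decide_eq_true (hw1 i (List.mem_range.1 hi))⟩
  have h2 := h t₁ hT₁
  rw [List.all_eq_true] at h2
  have hT₂ : t₂ ∈ (List.range p).filter fun t₂ => (List.range (L - ℓ₁ + 1)).all fun i => decide ((t₂ + j * i) % p < n₁) := by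
    rw [List.mem_filter, List.mem_range, List.all_eq_true]
    exact ⟨ht₂, fun i hi => decide_eq_true (hw2 i (List.mem_range.1 hi))⟩
  have h3 := h2 t₂ hT₂
  rw [Bool.or_eq_true, Bool.or_eq_true, Bool.or_eq_true, Bool.not_eq_true', Bool.not_eq_true', Bool.not_eq_true', decide_eq_false_iff_not,
    decide_eq_true_eq, hpre, hcov] at h3
  rcases h3 with ((h3 | h3) | h3) | h3
  · exact absurd hcard h3
  · exact absurd h3 (by decide)
  · exact absurd h3 (by decide)
  · exact h3

end Alpha

end Summit.MatrixMultiplication.OmegaCensus.CubeNB
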